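import Summits.QuantumFields.QCD.Theses.RenormalisedVafaWitten
import Literature.Analysis.Matrix.CoerciveCombesThomas
import HarnessLib

/-!
# Route `RenormalisedVafaWitten` (QCD): the support item `AccretiveCombesThomas` (stmt-QuantumFields-8696)

COMBES–THOMAS WITH THE NUMERICAL RANGE IN PLACE OF THE SPECTRUM (abstract finite form): on a finite index set with a
symmetric integer quasi-metric `dist`, a matrix `D` of range `≤ 1` that is `m`-accretive (`m ∑‖vᵢ‖² ≤ Re⟨v, Dv⟩`, `m > 0`)
with off-diagonal row and column `ℓ¹`-sums `≤ h` is invertible and, for every `θ ≥ 0` with `h(e^θ − 1) ≤ m/2`, obeys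
`‖D⁻¹ i j‖ ≤ (2/m) e^{−θ·dist i j}`.

Proof: accretive ⇒ coercive (`m² ∑‖vᵢ‖² ≤ ∑‖(Dv)ᵢ‖²`, Cauchy–Schwarz `Finset.sum_mul_sq_le_sq_mul_sq`), the
`dist ≠ 0` off-diagonal sums are dominated by the `j ≠ i` ones (`dist i i = 0`), and the tree's coercive Combes–Thomas
bound `Literature.Analysis.Matrix.coercive_combes_thomas` (p97672) concludes with `g = m`.  Nothing is asserted about QCD;
no summit, leg or crux statement is proved (width seat ym-t4-w17 g0, free hands; the item carried an unlanded candidate proof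
of 2026-08-16 by the line lead of stmt-8968, unreadable from this seat — re-derived here).
-/

set_option autoImplicit false

namespace Summit.QuantumFields.QCD.Theorems

open Finset

/-- **Accretive ⇒ coercive** (finite Cauchy–Schwarz): `m ∑‖vᵢ‖² ≤ Re ∑ v̄ᵢ (Dv)ᵢ` for all `v`, `m > 0`, gives
`m² ∑‖vᵢ‖² ≤ ∑‖(Dv)ᵢ‖²`. [folklore] -/
theorem coercive_of_accretive {ι : Type} [Fintype ι] (D : Matrix ι ι ℂ) (m : ℝ) (hm : 0 < m)
    (hacc : ∀ v : ι → ℂ, m * ∑ i, ‖v i‖ ^ 2 ≤ (∑ i, star (v i) * D.mulVec v i).re) (v : ι → ℂ) :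
    m ^ 2 * ∑ i, ‖v i‖ ^ 2 ≤ ∑ i, ‖(D.mulVec v) i‖ ^ 2 := by
  set S : ℝ := ∑ i, ‖v i‖ ^ 2 with hS
  set T : ℝ := ∑ i, ‖(D.mulVec v) i‖ ^ 2 with hT
  set P : ℝ := ∑ i, ‖v i‖ * ‖(D.mulVec v) i‖ with hP
  have hS0 : 0 ≤ S := sum_nonneg fun i _ => by positivity
  have hT0 : 0 ≤ T := sum_nonneg fun i _ => by positivity
  -- `m S ≤ Re⟨v,Dv⟩ ≤ P`
  have h1 : m * S ≤ P := by
    refine (hacc v).trans ?_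
    rw [Complex.re_sum]
    refine sum_le_sum fun i _ => ?_
    refine (Complex.re_le_norm _).trans ?_
    rw [norm_mul, norm_star]
  -- `P² ≤ S T`
  have h2 : P ^ 2 ≤ S * T := by
    have := sum_mul_sq_le_sq_mul_sq univ (fun i => ‖v i‖) (fun i => ‖(D.mulVec v) i‖)
    simpa only [hP, hS, hT] using this
  rcases hS0.eq_or_lt with hS00 | hSpos
  · rw [← hS00, mul_zero]; exact hT0
  · have h3 : (m * S) ^ 2 ≤ P ^ 2 := by
      have hmS : 0 ≤ m * S := by positivity
      exact pow_le_pow_left₀ hmS h1 2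
    have h4 : m ^ 2 * S * S ≤ T * S := by nlinarith
    exact le_of_mul_le_mul_right h4 hSpos

/-- **Accretive Combes–Thomas** (the item's abstract form), from the tree's coercive Combes–Thomas bound. [folklore] -/
theorem accretive_combes_thomas (ι : Type) [Fintype ι] [DecidableEq ι] (dist : ι → ι → ℕ) (D : Matrix ι ι ℂ)
    (m h θ : ℝ) (hd0 : ∀ i, dist i i = 0) (hds : ∀ i j, dist i j = dist j i)
    (hdt : ∀ i j k, dist i k ≤ dist i j + dist j k) (hrange : ∀ i j, D i j ≠ 0 → dist i j ≤ 1) (hm : 0 < m)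
    (hacc : ∀ v : ι → ℂ, m * ∑ i, ‖v i‖ ^ 2 ≤ (∑ i, star (v i) * D.mulVec v i).re)
    (hrow : ∀ i, ∑ j ∈ Finset.univ.erase i, ‖D i j‖ ≤ h) (hcol : ∀ j, ∑ i ∈ Finset.univ.erase j, ‖D i j‖ ≤ h)
    (hθ : 0 ≤ θ) (hη : h * (Real.exp θ - 1) ≤ m / 2) :
    IsUnit D.det ∧ ∀ i j, ‖D⁻¹ i j‖ ≤ 2 / m * Real.exp (-(θ * dist i j)) := by
  -- the `dist ≠ 0` sums are sub-sums of the `≠ i` sums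
  have hsub : ∀ i, univ.filter (fun j => dist i j ≠ 0) ⊆ univ.erase i := fun i j hj => by
    rw [mem_filter] at hj
    rw [mem_erase]
    exact ⟨fun hji => hj.2 (by rw [hji, hd0]), mem_univ _⟩
  have hsub' : ∀ j, univ.filter (fun i => dist i j ≠ 0) ⊆ univ.erase j := fun j i hi => by
    rw [mem_filter] at hi
    rw [mem_erase]
    exact ⟨fun hij => hi.2 (by rw [hij, hd0]), mem_univ _⟩
  have hrow' : ∀ i, ∑ j ∈ univ.filter (fun j => dist i j ≠ 0), ‖D i j‖ ≤ h := fun i =>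
    (sum_le_sum_of_subset_of_nonneg (hsub i) fun _ _ _ => norm_nonneg _).trans (hrow i)
  have hcol' : ∀ j, ∑ i ∈ univ.filter (fun i => dist i j ≠ 0), ‖D i j‖ ≤ h := fun j =>
    (sum_le_sum_of_subset_of_nonneg (hsub' j) fun _ _ _ => norm_nonneg _).trans (hcol j)
  exact Literature.Analysis.Matrix.coercive_combes_thomas dist hd0 hds hdt D hrange h hrow' hcol' m θ hm hθ
    (coercive_of_accretive D m hm hacc) hη

/-- **Item stmt-QuantumFields-8696 `RenormalisedVafaWitten.AccretiveCombesThomas` holds.** [folklore] -/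
theorem renormalisedVafaWitten_accretiveCombesThomas_proof :
    Summit.QuantumFields.QCD.Theses.RenormalisedVafaWitten.AccretiveCombesThomas := by
  unfold Summit.QuantumFields.QCD.Theses.RenormalisedVafaWitten.AccretiveCombesThomas
  intro ι _ _ dist D m h θ hd0 hds hdt hrange hm hacc hrow hcol hθ hη
  exact accretive_combes_thomas ι dist D m h θ hd0 hds hdt hrange hm hacc hrow hcol hθ hη

end Summit.QuantumFields.QCD.Theorems
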